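import Literature.NumberTheory.Irrationality.Zudilin2003.ZetaFourBricks
import Literature.NumberTheory.Irrationality.Zudilin2003.ZetaFourLimit
import HarnessLib

/-!
# Zudilin 2003 (JTNB), §2 Lemma 4 and the inclusions (6) of Theorem 1: `6D_nu_n ∈ ℤ`, `6D_n⁵v_n ∈ ℤ`

Topic `Literature/NumberTheory/Irrationality/Zudilin2003`, sub-namespace `ZetaFour`. Source: W. Zudilin, *Well-poised
hypergeometric service for diophantine problems of zeta values*, J. Théor. Nombres Bordeaux **15** (2003) 593–626
[Zudilin2003WellPoised], §2, READ ON THE PAGE (held text `paper:galaxy-pdf-1593531969313998860`, p0004–p0007):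
**Lemma 4.** "The coefficients `U_n, U_n', U_n'', U_n''', V_n` in the representation (12) satisfy the difference
equation (3) for `n = 1, 2, …`. *Proof.* Write the partial-fraction expansion (20) in the form
`R_n(t) = Σ_{j=1}^4 Σ_{k=−∞}^{+∞} A_{jk}/(t+k)^j` … Multiply both sides of (24) by `(t+k)⁴`, take `(4−j)`th derivative
of the result, substitute `t = −k` and sum over all `k ∈ ℤ`; this procedure yields that, for each `j`, the numbers
(21) … satisfy the difference equation (3)." Then (display before Lemma 5) `R_0(t) = 2/t³`,
`R_1(t) = −4/t⁴ + 4/(t+1)⁴ + 12/t³ + 12/(t+1)³ − 13/t² + 13/(t+1)²`, so `U_0' = 6`, `U_0 = U_0'' = U_0''' = V_0 = 0`,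
`U_1' = 72`, `V_1 = 78`, `U_1 = U_1'' = U_1''' = 0`; **Lemma 5**: `F_n = U_n'ζ(4) − V_n` with `D_nU_n' ∈ ℤ`,
`D_n⁵V_n ∈ ℤ`; "the sequences `u_n := U_n'/6` and `v_n := V_n/6` satisfy the difference equation (3) and initial
conditions (5)" — whence Theorem 1 (6): `6D_nu_n ∈ ℤ`, `6D_n⁵v_n ∈ ℤ`.

## How it is followed

Lemma 4 is proved AT THE LEVEL OF PARTIAL-FRACTION DATA, exactly as the Catalan twin `Zudilin2003/CatalanSeries.lean`
does (the "multiply by `(t+k)⁴`, differentiate, put `t = −k`, sum over `k`" of the source is the statement that the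
pole-coefficient sums of `S_n(t+1) − S_n(t)` vanish): the certificate `S_n = s_nR_n` of Lemma 2 has only integer poles
(`2t+n` cancels), and `S_n(t)/(t+2n+1)` is a proper rational function with poles on the grid `{0, −1, …, −(2n+1)}` of
order `≤ 6` (`numT`, `exists_pf_T` by `CressonFischlerRivoal2008.exists_partialFractions`); absorbing the linear
factor gives data `sD n` and a constant `sK n` with `S_n(τ+1) = sK n + Σ sD/(τ+p+1)^{o+1}` (`sD_spec`). The datum
`comb m` of `(m+2)⁵R_{m+2} − b(m+1)R_{m+1} − c(m+1)R_m − S_{m+1}(·+1) + S_{m+1}` on the grid `{0,…,−(2m+4)}` vanishes at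
every natural argument (Lemma 2 = `ZetaFourTelescoping.lemma2`, over `ℚ`), hence is zero (`BallRivoal.pf_unique`), and
summing its order-`o` coefficients over the poles kills the two `S`-terms (a shift does not change coefficient sums):
**`coefU_rec`** (Lemma 4 for `U_n''' , U_n'', U_n', U_n`). The data of `R_0`, `R_1` (`tab0`, `tab1`, by uniqueness)
give the printed initial values (`coefU_zero`, `coefU_one`), so `U_n = U_n'' = U_n''' = 0` and `U_n' = 6u_n`
(`coefU_eq`); with Lemma 1 (`ZetaFourBricks.lemma1`) and Lemma 5 (`ZetaFourLimit.lemma5_holds`) `V_n = 6v_n`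
(`coefV_eq`), and the integrality clause of Lemma 1 gives **`theorem1_inclusions_holds`**.

Everything PROVED (0 sorry); no named facts. HONEST FRAMING (cell zeta5-irr): a printed `ζ(4)` construction;
nothing about `ζ(5)`; as printed (p0004) the forms `6D_n⁵(u_nζ(4) − v_n)` do not tend to `0`; no rung moves.
-/

noncomputable section

open Finset Filter Topology Polynomial
open scoped Nat

namespace Literature.NumberTheory.Irrationality.Zudilin2003.ZetaFour

open Literature.NumberTheory.Transcendental (zetaValue)
open Literature.NumberTheory.Transcendental.BallRivoal (poch pfEval IsInt pf_unique pfEval_sub' pfEval_add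
  pfEval_const_mul)
open Literature.NumberTheory.Irrationality.CressonFischlerRivoal2008 (exists_partialFractions)

/-! ### The certificate over `ℚ` and Lemma 2 at the naturals -/

/-- `S_n = s_nR_n` with rational arguments and values. [cite: Zudilin2003WellPoised, §2 eq. (23)] -/
def Srat (n : ℕ) (t : ℚ) : ℚ :=
  sNum (n : ℚ) t / ((2 * t + n) * (t + 2 * n - 1) ^ 2 * (t + 2 * n) ^ 2) * Rrat n t

/-- `Srat` is `S` on rationals. [cite: Zudilin2003WellPoised, §2 eq. (23)] -/
theorem cast_Srat (n : ℕ) (t : ℚ) : ((Srat n t : ℚ) : ℝ) = S n t := by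
  rw [S, s, ← cast_Rrat, Srat, sNum, sNum]
  push_cast
  ring

/-- **Lemma 2 over `ℚ` at `t = k+1`** (`n = m+1`):
`(m+2)⁵R_{m+2}(k+1) − b(m+1)R_{m+1}(k+1) − c(m+1)R_m(k+1) = S_{m+1}(k+2) − S_{m+1}(k+1)`.
[cite: Zudilin2003WellPoised, §2 Lemma 2, eq. (24)] -/
theorem lemma2_rat (m k : ℕ) :
    ((m : ℚ) + 2) ^ 5 * Rrat (m + 2) ((k : ℚ) + 1) - b ((m : ℚ) + 1) * Rrat (m + 1) ((k : ℚ) + 1) -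
        c ((m : ℚ) + 1) * Rrat m ((k : ℚ) + 1) = Srat (m + 1) ((k : ℚ) + 2) - Srat (m + 1) ((k : ℚ) + 1) := by
  have h := lemma2 (m + 1) (by omega) ((k : ℝ) + 1) (by positivity)
  rw [show m + 1 + 1 = m + 2 from rfl, Nat.add_sub_cancel] at h
  have h' : ((((m : ℚ) + 2) ^ 5 * Rrat (m + 2) ((k : ℚ) + 1) - b ((m : ℚ) + 1) * Rrat (m + 1) ((k : ℚ) + 1) -
      c ((m : ℚ) + 1) * Rrat m ((k : ℚ) + 1) : ℚ) : ℝ) =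
      ((Srat (m + 1) ((k : ℚ) + 2) - Srat (m + 1) ((k : ℚ) + 1) : ℚ) : ℝ) := by
    rw [b, c] at h ⊢
    push_cast
    rw [cast_Rrat, cast_Rrat, cast_Rrat, cast_Srat, cast_Srat]
    push_cast at h ⊢
    rw [show (k : ℝ) + 2 = k + 1 + 1 by ring]
    linear_combination h
  exact_mod_cast h'

/-! ### The certificate as a proper rational function: `S_n(t)/(t+2n+1) = numT_n(t)/∏_{p≤2n+1}(t+p)⁶` -/

/-- The numerator (23) as a polynomial over `ℚ`. [cite: Zudilin2003WellPoised, §2 eq. (23)] -/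
def sNumQ (n : ℕ) : ℚ[X] := sNum (C (n : ℚ)) X

/-- `sNumQ n` evaluates to `sNum n`. [cite: Zudilin2003WellPoised, §2 eq. (23)] -/
theorem eval_sNumQ (n : ℕ) (t : ℚ) : (sNumQ n).eval t = sNum (n : ℚ) t := by
  simp only [sNumQ, sNum, eval_add, eval_sub, eval_neg, eval_mul, eval_pow, eval_C, eval_X, eval_ofNat, eval_one]

/-- `deg sNumQ ≤ 8`. [cite: Zudilin2003WellPoised, §2 eq. (23)] -/
theorem natDegree_sNumQ_le (n : ℕ) : (sNumQ n).natDegree ≤ 8 := by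
  unfold sNumQ sNum
  compute_degree!

/-- `A_n` as a polynomial: `∏_{j<n}(X − (j+1))`. [cite: Zudilin2003WellPoised, §2 eq. (10)] -/
def Apoly (n : ℕ) : ℚ[X] := ∏ j ∈ range n, (X - C ((j : ℚ) + 1))

/-- `B_n` as a polynomial: `∏_{j<n}(X + n + (j+1))`. [cite: Zudilin2003WellPoised, §2 eq. (10)] -/
def Bpoly (n : ℕ) : ℚ[X] := ∏ j ∈ range n, (X + C (n : ℚ) + C ((j : ℚ) + 1))

/-- The pole multiplicities of `S_n(t)/(t+2n+1)` on the grid `p ≤ 2n+1`: `4` on `p ≤ n` (from `C_n⁴`), `2` at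
`2n−1, 2n` (from `s_n`), `1` at `2n+1`. [cite: Zudilin2003WellPoised, §2 eqs. (10), (23)] -/
def dT (n p : ℕ) : ℕ :=
  (if p ≤ n then 4 else 0) + (if p = 2 * n - 1 then 2 else 0) + (if p = 2 * n then 2 else 0) +
    (if p = 2 * n + 1 then 1 else 0)

/-- `dT ≤ 6` (`n ≥ 1`). [cite: Zudilin2003WellPoised, §2 eqs. (10), (23)] -/
theorem dT_le (n : ℕ) (hn : 1 ≤ n) (p : ℕ) : dT n p ≤ 6 := by
  unfold dT; split_ifs <;> omega

/-- `Σ_{p≤2n+1} dT = 4n+9` (`n ≥ 1`). [cite: Zudilin2003WellPoised, §2 eqs. (10), (23)] -/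
theorem sum_dT (n : ℕ) (hn : 1 ≤ n) : ∑ p ∈ range (2 * n + 2), dT n p = 4 * n + 9 := by
  unfold dT
  rw [sum_add_distrib, sum_add_distrib, sum_add_distrib, sum_ite_eq', sum_ite_eq', sum_ite_eq']
  have hf : ∑ p ∈ range (2 * n + 2), (if p ≤ n then 4 else 0) = 4 * (n + 1) := by
    rw [sum_ite, sum_const_zero, add_zero, sum_const, smul_eq_mul]
    have : (range (2 * n + 2)).filter (fun p => p ≤ n) = range (n + 1) := by
      ext p; simp only [mem_filter, mem_range]; omega
    rw [this, card_range]
    ring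
  rw [hf, if_pos (mem_range.2 (by omega)), if_pos (mem_range.2 (by omega)), if_pos (mem_range.2 (by omega))]
  ring

/-- The pole part `DdT = C_n(X)⁴(X+2n−1)²(X+2n)²(X+2n+1)` and the complementary part `DeT` of `∏_{p≤2n+1}(X+p)⁶`.
[cite: Zudilin2003WellPoised, §2 eqs. (10), (23)] -/
def DdT (n : ℕ) : ℚ[X] := ∏ p ∈ range (2 * n + 2), (X + C (p : ℚ)) ^ dT n p

/-- See `DdT`. [cite: Zudilin2003WellPoised, §2 eqs. (10), (23)] -/
def DeT (n : ℕ) : ℚ[X] := ∏ p ∈ range (2 * n + 2), (X + C (p : ℚ)) ^ (6 - dT n p)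

/-- The common denominator `∏_{p≤2n+1}(X+p)⁶`. [cite: Zudilin2003WellPoised, §2 eqs. (10), (23)] -/
def DenT (n : ℕ) : ℚ[X] := ∏ p ∈ range (2 * n + 2), (X + C (p : ℚ)) ^ 6

/-- `∏(X+p)⁶ = DdT·DeT`. [cite: Zudilin2003WellPoised, §2 eqs. (10), (23)] -/
theorem DenT_eq (n : ℕ) (hn : 1 ≤ n) : DenT n = DdT n * DeT n := by
  unfold DenT DdT DeT
  rw [← prod_mul_distrib]
  refine prod_congr rfl fun p _ => ?_
  rw [← pow_add, Nat.add_sub_cancel' (dT_le n hn p)]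

/-- `DdT = (∏_{p≤n}(X+p))⁴(X+2n−1)²(X+2n)²(X+2n+1)`. [cite: Zudilin2003WellPoised, §2 eqs. (10), (23)] -/
theorem DdT_eq (n : ℕ) :
    DdT n = (∏ p ∈ range (n + 1), (X + C (p : ℚ))) ^ 4 * (X + C (((2 * n - 1 : ℕ) : ℚ))) ^ 2 *
      (X + C (((2 * n : ℕ) : ℚ))) ^ 2 * (X + C (((2 * n + 1 : ℕ) : ℚ))) := by
  unfold DdT dT
  simp only [pow_add, prod_mul_distrib]
  have h1 : ∏ p ∈ range (2 * n + 2), (X + C (p : ℚ)) ^ (if p ≤ n then 4 else 0) =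
      (∏ p ∈ range (n + 1), (X + C (p : ℚ))) ^ 4 := by
    rw [← prod_pow]
    have : range (n + 1) = (range (2 * n + 2)).filter (fun p => p ≤ n) := by
      ext p; simp only [mem_filter, mem_range]; omega
    rw [this, prod_filter]
    refine prod_congr rfl fun p _ => ?_
    split_ifs <;> simp
  have h2 : ∀ a k : ℕ, a < 2 * n + 2 →
      ∏ p ∈ range (2 * n + 2), (X + C (p : ℚ)) ^ (if p = a then k else 0) = (X + C ((a : ℕ) : ℚ)) ^ k := by
    intro a k ha
    have e : ∀ p ∈ range (2 * n + 2), (X + C (p : ℚ)) ^ (if p = a then k else 0) =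
        if p = a then (X + C (p : ℚ)) ^ k else 1 := fun p _ => by split_ifs <;> simp
    rw [prod_congr rfl e, prod_ite_eq', if_pos (mem_range.2 ha)]
  rw [h1, h2 _ 2 (by omega), h2 _ 2 (by omega), h2 _ 1 (by omega), pow_one]

/-- `numT_n = (−1)ⁿ·sNum_n·A_n²·B_n²·DeT_n`, the numerator of `S_n(t)/(t+2n+1)` over `∏_{p≤2n+1}(t+p)⁶`.
[cite: Zudilin2003WellPoised, §2 eqs. (10), (23)] -/
def numT (n : ℕ) : ℚ[X] := C ((-1 : ℚ) ^ n) * sNumQ n * (Apoly n ^ 2 * Bpoly n ^ 2 * DeT n)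

/-- `deg numT_n ≤ 12n + 11 < 6(2n+2)` (`n ≥ 1`). [cite: Zudilin2003WellPoised, §2 (proof of Lemma 3: "S_n(t) = O(1)")] -/
theorem natDegree_numT_le (n : ℕ) (hn : 1 ≤ n) : (numT n).natDegree ≤ 12 * n + 11 := by
  have hA : (Apoly n).natDegree ≤ n := by
    unfold Apoly
    refine (natDegree_prod_le _ _).trans ((sum_le_sum fun j _ => (natDegree_X_sub_C _).le).trans ?_)
    simp
  have hB : (Bpoly n).natDegree ≤ n := by
    unfold Bpoly
    have hj : ∀ j ∈ range n, (X + C (n : ℚ) + C ((j : ℚ) + 1)).natDegree ≤ 1 := fun j _ => by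
      rw [add_assoc, ← C_add]; exact (natDegree_X_add_C _).le
    refine (natDegree_prod_le _ _).trans ((sum_le_sum hj).trans ?_)
    simp
  have hE : (DeT n).natDegree ≤ 8 * n + 3 := by
    unfold DeT
    refine (natDegree_prod_le _ _).trans ?_
    have h1 : ∑ p ∈ range (2 * n + 2), ((X + C (p : ℚ)) ^ (6 - dT n p)).natDegree ≤
        ∑ p ∈ range (2 * n + 2), (6 - dT n p) :=
      sum_le_sum fun p _ => natDegree_pow_le.trans (by rw [natDegree_X_add_C, mul_one])
    have h2 : ∑ p ∈ range (2 * n + 2), (6 - dT n p) + ∑ p ∈ range (2 * n + 2), dT n p = 6 * (2 * n + 2) := by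
      rw [← sum_add_distrib, sum_congr rfl fun p _ => Nat.sub_add_cancel (dT_le n hn p), sum_const, card_range,
        smul_eq_mul, mul_comm]
    have h3 := sum_dT n hn
    omega
  have hnum : (numT n).natDegree ≤ 12 * n + 11 := by
    unfold numT
    refine natDegree_mul_le.trans ?_
    have h1 : (C ((-1 : ℚ) ^ n) * sNumQ n).natDegree ≤ 8 :=
      natDegree_mul_le.trans (by rw [natDegree_C, zero_add]; exact natDegree_sNumQ_le n)
    have h2 : (Apoly n ^ 2 * Bpoly n ^ 2 * DeT n).natDegree ≤ 2 * n + 2 * n + (8 * n + 3) := by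
      refine natDegree_mul_le.trans (add_le_add (natDegree_mul_le.trans (add_le_add ?_ ?_)) hE)
      · exact natDegree_pow_le.trans (by omega)
      · exact natDegree_pow_le.trans (by omega)
    omega
  exact hnum

/-- Evaluations of the polynomial blocks. [cite: Zudilin2003WellPoised, §2 eqs. (10), (23)] -/
theorem eval_blocks (n : ℕ) (t : ℚ) :
    (Apoly n).eval t = ∏ j ∈ range n, (t - (j + 1)) ∧
    (Bpoly n).eval t = ∏ j ∈ range n, (t + n + (j + 1)) ∧
    (DeT n).eval t = ∏ p ∈ range (2 * n + 2), (t + p) ^ (6 - dT n p) ∧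
    (DenT n).eval t = ∏ p ∈ range (2 * n + 2), (t + p) ^ 6 ∧
    (DdT n).eval t = (∏ p ∈ range (n + 1), (t + p)) ^ 4 * (t + (((2 * n - 1 : ℕ) : ℚ))) ^ 2 *
      (t + (((2 * n : ℕ) : ℚ))) ^ 2 * (t + (((2 * n + 1 : ℕ) : ℚ))) := by
  refine ⟨?_, ?_, ?_, ?_, ?_⟩
  · simp [Apoly, eval_prod]
  · simp [Bpoly, eval_prod]
  · simp [DeT, eval_prod]
  · simp [DenT, eval_prod]
  · rw [DdT_eq]; simp [eval_prod]

/-- **`S_n(t)/(t+2n+1) = numT_n(t)/∏_{p≤2n+1}(t+p)⁶`** away from the grid and from `2t+n = 0` (`n ≥ 1`).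
[cite: Zudilin2003WellPoised, §2 eqs. (10), (23)] -/
theorem Srat_div_eq (n : ℕ) (hn : 1 ≤ n) (t : ℚ) (ht : ∀ p, p ≤ 2 * n + 1 → t + p ≠ 0) (h2 : 2 * t + n ≠ 0) :
    Srat n t / (t + 2 * n + 1) = (numT n).eval t / (DenT n).eval t := by
  obtain ⟨hA, hB, hE, -, hD⟩ := eval_blocks n t
  have hDen : (DenT n).eval t = (DdT n).eval t * (DeT n).eval t := by rw [DenT_eq n hn, eval_mul]
  have hC : ∏ p ∈ range (n + 1), (t + p) ≠ 0 :=
    prod_ne_zero_iff.2 fun p hp => ht p (by have := mem_range.1 hp; omega)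
  have hEne : (DeT n).eval t ≠ 0 := by
    rw [hE]; exact prod_ne_zero_iff.2 fun p hp => pow_ne_zero _ (ht p (by have := mem_range.1 hp; omega))
  have h3 : t + 2 * n - 1 ≠ 0 := by
    have := ht (2 * n - 1) (by omega)
    rw [Nat.cast_sub (by omega), Nat.cast_mul] at this
    push_cast at this
    intro h; exact this (by linarith)
  have h4 : t + 2 * n ≠ 0 := by have := ht (2 * n) (by omega); push_cast at this; exact this
  have h5 : t + 2 * n + 1 ≠ 0 := by
    have := ht (2 * n + 1) le_rfl; push_cast at this; intro h; exact this (by linarith)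
  have hD' : (DdT n).eval t = (∏ p ∈ range (n + 1), (t + p)) ^ 4 * (t + 2 * n - 1) ^ 2 * (t + 2 * n) ^ 2 *
      (t + 2 * n + 1) := by
    rw [hD, Nat.cast_sub (by omega)]; push_cast; ring
  rw [hDen, hD', numT, eval_mul, eval_mul, eval_C, eval_sNumQ, eval_mul, eval_mul, eval_pow, eval_pow, hA, hB]
  unfold Srat Rrat
  field_simp

/-- Partial-fraction data of `T_n(τ+1) = S_n(τ+1)/(τ+2n+2)` on the grid `p ≤ 2n+1`, orders `≤ 6`.
[cite: Zudilin2003WellPoised, §2 (proof of Lemma 4)] -/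
theorem exists_pf_T (n : ℕ) (hn : 1 ≤ n) :
    ∃ d : ℕ → ℕ → ℚ, ∀ τ : ℚ, (∀ p, p ≤ 2 * n + 1 → τ + p + 1 ≠ 0) → 2 * (τ + 1) + n ≠ 0 →
      pfEval (2 * n + 1) 6 d τ = Srat n (τ + 1) / (τ + 1 + 2 * n + 1) := by
  have hdeg : ((numT n).comp (X + 1)).degree < ((6 * (2 * n + 1 + 1) : ℕ) : WithBot ℕ) := by
    have h1 : ((numT n).comp (X + 1)).natDegree = (numT n).natDegree := by
      rw [natDegree_comp, show (X + 1 : ℚ[X]) = X + C 1 by simp, natDegree_X_add_C, mul_one]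
    have h2 : ((numT n).comp (X + 1)).natDegree ≤ 12 * n + 11 := h1 ▸ natDegree_numT_le n hn
    exact (degree_le_of_natDegree_le h2).trans_lt
      (by exact_mod_cast (show 12 * n + 11 < 6 * (2 * n + 1 + 1) by omega))
  obtain ⟨d, hd⟩ := exists_partialFractions (2 * n + 1) 6 (by norm_num) _ hdeg
  refine ⟨d, fun τ hτ h2 => ?_⟩
  rw [hd τ hτ, eval_comp, eval_add, eval_X, eval_one,
    Srat_div_eq n hn (τ + 1) (fun p hp h => hτ p hp (by linarith)) h2, (eval_blocks n (τ + 1)).2.2.2.1, poch,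
    ← prod_pow]

/-! ### The data of `S_n`: absorbing the linear factor `t + 2n + 1` -/

/-- THE data of `T_{m+1}(τ+1) = S_{m+1}(τ+1)/(τ+2m+4)` (chosen). [cite: Zudilin2003WellPoised, §2 (proof of Lemma 4)] -/
def pfT (m : ℕ) : ℕ → ℕ → ℚ := (exists_pf_T (m + 1) (Nat.succ_pos m)).choose

/-- Defining property of `pfT`. [cite: Zudilin2003WellPoised, §2 (proof of Lemma 4)] -/
theorem pfT_spec (m : ℕ) (τ : ℚ) (hτ : ∀ p, p ≤ 2 * m + 3 → τ + p + 1 ≠ 0) (h2 : 2 * (τ + 1) + ((m : ℚ) + 1) ≠ 0) :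
    pfEval (2 * m + 3) 6 (pfT m) τ = Srat (m + 1) (τ + 1) / (τ + 1 + 2 * ((m : ℚ) + 1) + 1) := by
  have h := (exists_pf_T (m + 1) (Nat.succ_pos m)).choose_spec τ (fun p hp => hτ p (by omega)) (by
    push_cast; exact h2)
  have e : 2 * m + 3 = 2 * (m + 1) + 1 := by ring
  rw [e, show (2 : ℚ) * ((m : ℚ) + 1) = 2 * ((m + 1 : ℕ) : ℚ) by push_cast; ring]
  unfold pfT
  exact h

/-- Multiplying data by the linear factor `(τ+p+1) + (2n+1−p)`: `d'_{o,p} = (2n+1−p)d_{o,p} + d_{o+1,p}`.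
[cite: Zudilin2003WellPoised, §2 (proof of Lemma 4)] -/
def mulLin (n : ℕ) (d : ℕ → ℕ → ℚ) : ℕ → ℕ → ℚ := fun o p =>
  (2 * (n : ℚ) + 1 - p) * d o p + if o < 5 then d (o + 1) p else 0

/-- One pole of `mulLin`. [cite: Zudilin2003WellPoised, §2 (proof of Lemma 4)] -/
private theorem mulLin_pole (n : ℕ) (d : ℕ → ℕ → ℚ) (τ : ℚ) (p : ℕ) (hτ : τ + p + 1 ≠ 0) :
    ∑ o ∈ range 6, mulLin n d o p / (τ + p + 1) ^ (o + 1) =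
      (τ + 1 + 2 * n + 1) * ∑ o ∈ range 6, d o p / (τ + p + 1) ^ (o + 1) - d 0 p := by
  simp only [sum_range_succ, sum_range_zero, mulLin]
  norm_num
  field_simp
  ring

/-- `pfEval (mulLin d) = (τ+2n+2)·pfEval d − Σ_p d_{0,p}`. [cite: Zudilin2003WellPoised, §2 (proof of Lemma 4)] -/
theorem pfEval_mulLin (N n : ℕ) (d : ℕ → ℕ → ℚ) (τ : ℚ) (hτ : ∀ p, p ≤ N → τ + p + 1 ≠ 0) :
    pfEval N 6 (mulLin n d) τ = (τ + 1 + 2 * n + 1) * pfEval N 6 d τ - ∑ p ∈ range (N + 1), d 0 p := by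
  unfold pfEval
  rw [sum_congr rfl fun p hp => mulLin_pole n d τ p (hτ p (Nat.lt_succ_iff.1 (mem_range.1 hp))),
    sum_sub_distrib, mul_sum]

/-- THE data of `S_{m+1}(τ+1)` (up to the constant `sK m`), grid `p ≤ 2m+3`, orders `≤ 6`.
[cite: Zudilin2003WellPoised, §2 (proof of Lemma 4)] -/
def sD (m : ℕ) : ℕ → ℕ → ℚ := mulLin (m + 1) (pfT m)

/-- The constant term `S_{m+1}(∞)`. [cite: Zudilin2003WellPoised, §2 (proof of Lemma 4)] -/
def sK (m : ℕ) : ℚ := ∑ p ∈ range (2 * m + 3 + 1), pfT m 0 p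

/-- **`S_{m+1}(τ+1) = sK m + Σ sD/(τ+p+1)^{o+1}`** for `τ` off the grid with `2(τ+1) + m + 1 ≠ 0`.
[cite: Zudilin2003WellPoised, §2 (proof of Lemma 4)] -/
theorem sD_spec (m : ℕ) (τ : ℚ) (hτ : ∀ p, p ≤ 2 * m + 3 → τ + p + 1 ≠ 0) (h2 : 2 * (τ + 1) + ((m : ℚ) + 1) ≠ 0) :
    pfEval (2 * m + 3) 6 (sD m) τ + sK m = Srat (m + 1) (τ + 1) := by
  have hne : τ + 1 + 2 * ((m : ℚ) + 1) + 1 ≠ 0 := by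
    have := hτ (2 * m + 3) le_rfl; push_cast at this; intro h; exact this (by linarith)
  rw [sD, pfEval_mulLin _ _ _ τ hτ, pfT_spec m τ hτ h2, sK]
  push_cast
  field_simp
  ring

/-- At naturals: `pfEval (sD m) k = S_{m+1}(k+1) − sK m`. [cite: Zudilin2003WellPoised, §2 (proof of Lemma 4)] -/
theorem sD_spec_nat (m k : ℕ) : pfEval (2 * m + 3) 6 (sD m) (k : ℚ) = Srat (m + 1) ((k : ℚ) + 1) - sK m := by
  have h := sD_spec m k (fun p _ => by positivity) (by positivity)
  linarith

/-! ### Lemma 4 at the level of data -/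

/-- Zero-extension of `R`-data (orders `< 4`, poles `≤ n`) to a bigger grid with orders `< 6`.
[cite: Zudilin2003WellPoised, §2 (proof of Lemma 4: "the formulae (18) remain valid for all k ∈ ℤ")] -/
def extR (n : ℕ) (c : ℕ → ℕ → ℚ) : ℕ → ℕ → ℚ := fun o p => if o < 4 ∧ p ≤ n then c o p else 0

/-- Extension does not change the evaluation. [cite: Zudilin2003WellPoised, §2 (proof of Lemma 4)] -/
theorem pfEval_extR (N n : ℕ) (h : n ≤ N) (c : ℕ → ℕ → ℚ) (τ : ℚ) : pfEval N 6 (extR n c) τ = pfEval n 4 c τ := by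
  unfold pfEval extR
  rw [← sum_subset (range_subset_range.2 (by omega : n + 1 ≤ N + 1))]
  · refine sum_congr rfl fun p hp => ?_
    have hp' : p ≤ n := Nat.lt_succ_iff.1 (mem_range.1 hp)
    rw [← sum_subset (range_subset_range.2 (by norm_num : 4 ≤ 6))]
    · exact sum_congr rfl fun o ho => by simp [mem_range.1 ho, hp']
    · intro o _ ho
      have : ¬ o < 4 := fun h' => ho (mem_range.2 h')
      simp [this]
  · intro p _ hp
    have : ¬ p ≤ n := fun h' => hp (mem_range.2 (Nat.lt_succ_of_le h'))
    simp [this]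

/-- Extension does not change coefficient sums. [cite: Zudilin2003WellPoised, §2 (proof of Lemma 4)] -/
theorem sum_extR (N n : ℕ) (h : n ≤ N) (c : ℕ → ℕ → ℚ) (o : ℕ) (ho : o < 4) :
    ∑ p ∈ range (N + 1), extR n c o p = ∑ p ∈ range (n + 1), c o p := by
  unfold extR
  rw [← sum_subset (range_subset_range.2 (by omega : n + 1 ≤ N + 1))]
  · exact sum_congr rfl fun p hp => by simp [ho, Nat.lt_succ_iff.1 (mem_range.1 hp)]
  · intro p _ hp
    have : ¬ p ≤ n := fun h' => hp (mem_range.2 (Nat.lt_succ_of_le h'))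
    simp [this]

/-- Zero-padding of data to more poles. [cite: Zudilin2003WellPoised, §2 (proof of Lemma 4)] -/
def padP (n : ℕ) (c : ℕ → ℕ → ℚ) : ℕ → ℕ → ℚ := fun o p => if p ≤ n then c o p else 0

/-- Padding does not change the evaluation. [cite: Zudilin2003WellPoised, §2 (proof of Lemma 4)] -/
theorem pfEval_padP (N n K : ℕ) (h : n ≤ N) (c : ℕ → ℕ → ℚ) (τ : ℚ) : pfEval N K (padP n c) τ = pfEval n K c τ := by
  unfold pfEval padP
  rw [← sum_subset (range_subset_range.2 (by omega : n + 1 ≤ N + 1))]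
  · exact sum_congr rfl fun p hp => by simp [Nat.lt_succ_iff.1 (mem_range.1 hp)]
  · intro p _ hp
    have : ¬ p ≤ n := fun h' => hp (mem_range.2 (Nat.lt_succ_of_le h'))
    simp [this]

/-- Padding does not change coefficient sums. [cite: Zudilin2003WellPoised, §2 (proof of Lemma 4)] -/
theorem sum_padP (N n : ℕ) (h : n ≤ N) (c : ℕ → ℕ → ℚ) (o : ℕ) :
    ∑ p ∈ range (N + 1), padP n c o p = ∑ p ∈ range (n + 1), c o p := by
  unfold padP
  rw [← sum_subset (range_subset_range.2 (by omega : n + 1 ≤ N + 1))]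
  · exact sum_congr rfl fun p hp => by simp [Nat.lt_succ_iff.1 (mem_range.1 hp)]
  · intro p _ hp
    have : ¬ p ≤ n := fun h' => hp (mem_range.2 (Nat.lt_succ_of_le h'))
    simp [this]

/-- Data shifted by one pole: the data of `τ ↦ G(τ+1)`. [cite: Zudilin2003WellPoised, §2 (proof of Lemma 4)] -/
def shiftP (c : ℕ → ℕ → ℚ) : ℕ → ℕ → ℚ := fun o p => if p = 0 then 0 else c o (p - 1)

/-- `pfEval (shiftP c) τ = pfEval c (τ+1)`. [cite: Zudilin2003WellPoised, §2 (proof of Lemma 4)] -/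
theorem pfEval_shiftP (n K : ℕ) (c : ℕ → ℕ → ℚ) (τ : ℚ) : pfEval (n + 1) K (shiftP c) τ = pfEval n K c (τ + 1) := by
  unfold pfEval shiftP
  rw [sum_range_succ']
  simp only [Nat.succ_ne_zero, if_false, if_true, zero_div, sum_const_zero, add_zero, Nat.add_sub_cancel]
  refine sum_congr rfl fun i _ => sum_congr rfl fun o _ => ?_
  push_cast
  ring

/-- **A shift does not change coefficient sums** (the heart of Lemma 4). [cite: Zudilin2003WellPoised, §2 (proof of Lemma 4)] -/
theorem sum_shiftP (n : ℕ) (c : ℕ → ℕ → ℚ) (o : ℕ) :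
    ∑ p ∈ range (n + 2), shiftP c o p = ∑ p ∈ range (n + 1), c o p := by
  unfold shiftP
  rw [sum_range_succ']
  simp only [Nat.succ_ne_zero, if_false, if_true, add_zero, Nat.add_sub_cancel]

/-- The datum of `(m+2)⁵R_{m+2} − b(m+1)R_{m+1} − c(m+1)R_m − S_{m+1}(·+1) + S_{m+1}` (shifted variable `τ = t − 1`,
grid `p ≤ 2m+4`, orders `≤ 6`). [cite: Zudilin2003WellPoised, §2 (proof of Lemma 4)] -/
def comb (m : ℕ) : ℕ → ℕ → ℚ := fun o p =>
  ((m : ℚ) + 2) ^ 5 * extR (m + 2) (pfR (m + 2)) o p - b ((m : ℚ) + 1) * extR (m + 1) (pfR (m + 1)) o p -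
    c ((m : ℚ) + 1) * extR m (pfR m) o p - shiftP (sD m) o p + padP (2 * m + 3) (sD m) o p

/-- Evaluation of `comb m`. [cite: Zudilin2003WellPoised, §2 (proof of Lemma 4)] -/
theorem pfEval_comb (m : ℕ) (τ : ℚ) :
    pfEval (2 * m + 4) 6 (comb m) τ =
      ((m : ℚ) + 2) ^ 5 * pfEval (m + 2) 4 (pfR (m + 2)) τ - b ((m : ℚ) + 1) * pfEval (m + 1) 4 (pfR (m + 1)) τ -
        c ((m : ℚ) + 1) * pfEval m 4 (pfR m) τ - pfEval (2 * m + 3) 6 (sD m) (τ + 1) +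
        pfEval (2 * m + 3) 6 (sD m) τ := by
  rw [← pfEval_extR (2 * m + 4) (m + 2) (by omega) (pfR (m + 2)) τ,
    ← pfEval_extR (2 * m + 4) (m + 1) (by omega) (pfR (m + 1)) τ, ← pfEval_extR (2 * m + 4) m (by omega) (pfR m) τ,
    ← pfEval_shiftP (2 * m + 3) 6 (sD m) τ, ← pfEval_padP (2 * m + 4) (2 * m + 3) 6 (by omega) (sD m) τ]
  unfold pfEval comb
  simp only [add_div, sub_div, sum_add_distrib, sum_sub_distrib, mul_sum, mul_div_assoc]

/-- `comb m` vanishes at every natural argument (Lemma 2). [cite: Zudilin2003WellPoised, §2 Lemma 2 and proof of Lemma 4] -/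
theorem pfEval_comb_nat (m k : ℕ) : pfEval (2 * m + 4) 6 (comb m) (k : ℚ) = 0 := by
  have h := lemma2_rat m k
  have h1 := sD_spec_nat m (k + 1)
  push_cast at h1
  rw [pfEval_comb, pfR_spec_nat, pfR_spec_nat, pfR_spec_nat, h1, sD_spec_nat,
    show (k : ℚ) + 1 + 1 = k + 2 by ring]
  linear_combination h

/-- **(24) at the level of data**: `comb m = 0`. [cite: Zudilin2003WellPoised, §2 (proof of Lemma 4)] -/
theorem comb_eq_zero (m o p : ℕ) (ho : o < 6) (hp : p ≤ 2 * m + 4) : comb m o p = 0 :=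
  pf_unique (2 * m + 4) 6 (comb m) 0 (fun k _ => pfEval_comb_nat m k) o p ho hp

/-- **Lemma 4 for the coefficient sums** `Σ_k A_{jk}^{(n)}`: for each order they solve (3).
[cite: Zudilin2003WellPoised, §2 Lemma 4] -/
theorem sum_pfR_rec (m o : ℕ) (ho : o < 4) :
    ((m : ℚ) + 2) ^ 5 * ∑ p ∈ range (m + 3), pfR (m + 2) o p =
      b ((m : ℚ) + 1) * ∑ p ∈ range (m + 2), pfR (m + 1) o p + c ((m : ℚ) + 1) * ∑ p ∈ range (m + 1), pfR m o p := by
  have h : ∑ p ∈ range (2 * m + 4 + 1), comb m o p = 0 :=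
    sum_eq_zero fun p hp => comb_eq_zero m o p (by omega) (Nat.lt_succ_iff.1 (mem_range.1 hp))
  unfold comb at h
  rw [sum_add_distrib, sum_sub_distrib, sum_sub_distrib, sum_sub_distrib, ← mul_sum, ← mul_sum, ← mul_sum,
    sum_extR _ _ (by omega) _ o ho, sum_extR _ _ (by omega) _ o ho, sum_extR _ _ (by omega) _ o ho,
    show 2 * m + 4 = (2 * m + 3) + 1 by ring, sum_shiftP, sum_padP _ _ (by omega)] at h
  linear_combination h

/-- **Lemma 4** (Zudilin 2003) for the four coefficient sequences `coefU n o`, `o < 4` (`U_n'''`, `U_n''`, `U_n'`,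
`U_n`): `(m+2)⁵U_{m+2} = b(m+1)U_{m+1} + c(m+1)U_m`. [cite: Zudilin2003WellPoised, §2 Lemma 4] -/
theorem coefU_rec (m o : ℕ) (ho : o < 4) :
    ((m : ℚ) + 2) ^ 5 * coefU (m + 2) o = b ((m : ℚ) + 1) * coefU (m + 1) o + c ((m : ℚ) + 1) * coefU m o := by
  unfold coefU
  have h := sum_pfR_rec m o ho
  rw [show m + 2 + 1 = m + 3 by ring]
  linear_combination ((o : ℚ) + 1) * h

/-! ### The data of `R_0` and `R_1`: initial values -/

/-- The data of `R_0(τ+1) = 2/(τ+1)³`. [cite: Zudilin2003WellPoised, §2 (display before Lemma 5)] -/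
def tab0 : ℕ → ℕ → ℚ := fun o p => if o = 2 ∧ p = 0 then 2 else 0

/-- `tab0` expands `R_0`. [cite: Zudilin2003WellPoised, §2 (display before Lemma 5)] -/
theorem tab0_eval (k : ℕ) : pfEval 0 4 tab0 (k : ℚ) = Rrat 0 ((k : ℚ) + 1) := by
  have hk : (k : ℚ) + 1 ≠ 0 := by positivity
  simp only [pfEval, tab0, Rrat, sum_range_succ, sum_range_zero, prod_range_succ, prod_range_zero]
  norm_num
  field_simp

/-- The data of `R_1(τ+1) = −13/t² + 12/t³ − 4/t⁴ + 13/(t+1)² + 12/(t+1)³ + 4/(t+1)⁴`, `t = τ+1`.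
[cite: Zudilin2003WellPoised, §2 (display before Lemma 5)] -/
def tab1 : ℕ → ℕ → ℚ := fun o p =>
  if p = 0 then (if o = 1 then -13 else if o = 2 then 12 else if o = 3 then -4 else 0)
  else if p = 1 then (if o = 1 then 13 else if o = 2 then 12 else if o = 3 then 4 else 0) else 0

/-- `tab1` expands `R_1`. [cite: Zudilin2003WellPoised, §2 (display before Lemma 5)] -/
theorem tab1_eval (k : ℕ) : pfEval 1 4 tab1 (k : ℚ) = Rrat 1 ((k : ℚ) + 1) := by
  have hk : (k : ℚ) + 1 ≠ 0 := by positivity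
  have hk2 : (k : ℚ) + 1 + 1 ≠ 0 := by positivity
  simp only [pfEval, tab1, Rrat, sum_range_succ, sum_range_zero, prod_range_succ, prod_range_zero]
  norm_num
  field_simp
  ring

/-- `U_0' = 6`, `U_0 = U_0'' = U_0''' = 0`. [cite: Zudilin2003WellPoised, §2 (display before Lemma 5)] -/
theorem coefU_zero (o : ℕ) (ho : o < 4) : coefU 0 o = if o = 2 then 6 else 0 := by
  have h : ∀ o', o' < 4 → pfR 0 o' 0 = tab0 o' 0 := fun o' ho' =>
    (pfR_eq_of_eval 0 tab0 tab0_eval o' 0 ho' le_rfl).symm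
  unfold coefU
  simp only [zero_add, sum_range_one, h o ho, tab0]
  interval_cases o <;> norm_num

/-- `U_1' = 72`, `U_1 = U_1'' = U_1''' = 0`. [cite: Zudilin2003WellPoised, §2 (display before Lemma 5)] -/
theorem coefU_one (o : ℕ) (ho : o < 4) : coefU 1 o = if o = 2 then 72 else 0 := by
  have h : ∀ o' p, o' < 4 → p ≤ 1 → pfR 1 o' p = tab1 o' p := fun o' p ho' hp =>
    (pfR_eq_of_eval 1 tab1 tab1_eval o' p ho' hp).symm
  unfold coefU
  simp only [sum_range_succ, sum_range_zero, h o 0 ho (by norm_num), h o 1 ho le_rfl, tab1]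
  interval_cases o <;> norm_num

/-! ### `U_n' = 6u_n`, `U_n = U_n'' = U_n''' = 0`, `V_n = 6v_n`, and the inclusions (6) -/

/-- The recursion (3) for `u` over `ℚ`, cleared form. [cite: Zudilin2003WellPoised, §2 eqs. (3), (5)] -/
theorem u_cleared_rat (m : ℕ) :
    ((m : ℚ) + 2) ^ 5 * u (m + 2) = b ((m : ℚ) + 1) * u (m + 1) + c ((m : ℚ) + 1) * u m := by
  have h := u_isSolution (m + 1) (by omega)
  rw [show m + 1 + 1 = m + 2 from rfl, Nat.add_sub_cancel] at h
  push_cast at h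
  linear_combination h

/-- **`U_n' = 6u_n` and `U_n = U_n'' = U_n''' = 0`** (Lemma 4 + the initial values: "the sequences
`u_n := U_n'/6` … satisfy the difference equation (3) and initial conditions (5)").
[cite: Zudilin2003WellPoised, §2 Lemma 5 (and the sentence after it)] -/
theorem coefU_eq (n : ℕ) : ∀ o, o < 4 → coefU n o = if o = 2 then 6 * u n else 0 := by
  induction n using Nat.twoStepInduction with
  | zero => intro o ho; rw [coefU_zero o ho]; norm_num [u, seq]
  | one => intro o ho; rw [coefU_one o ho]; norm_num [u, seq]
  | more m h0 h1 =>
    intro o ho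
    have hr := coefU_rec m o ho
    rw [h0 o ho, h1 o ho] at hr
    have hm : ((m : ℚ) + 2) ^ 5 ≠ 0 := by positivity
    split_ifs at hr ⊢ with h2
    · have hu := u_cleared_rat m
      apply mul_left_cancel₀ hm
      linear_combination hr - 6 * hu
    · simpa [hm] using hr

/-- **`V_n = 6v_n`** (from Lemma 1 `F_n = Σ U·ζ − V_n`, `U_n' = 6u_n`, the vanishing of the other `U`, and Lemma 5
`F_n = 6(u_nζ(4) − v_n)`). [cite: Zudilin2003WellPoised, §2 Lemma 5 (and the sentence after it)] -/
theorem coefV_eq (n : ℕ) : coefV n = 6 * v n := by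
  have h1 := lemma1 n
  have h5 := lemma5_holds n
  have e0 : coefU n 0 = 0 := by simpa using coefU_eq n 0 (by norm_num)
  have e1 : coefU n 1 = 0 := by simpa using coefU_eq n 1 (by norm_num)
  have e2 : coefU n 2 = 6 * u n := by simpa using coefU_eq n 2 (by norm_num)
  have e3 : coefU n 3 = 0 := by simpa using coefU_eq n 3 (by norm_num)
  simp only [sum_range_succ, sum_range_zero, e0, e1, e2, e3] at h1
  push_cast at h1
  have : ((coefV n : ℚ) : ℝ) = ((6 * v n : ℚ) : ℝ) := by push_cast; linarith
  exact_mod_cast this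

/-- **Theorem 1, inclusions (6)** (Zudilin 2003), discharged: `u_n > 0`, `v_n > 0` (`n ≥ 1`), `6D_nu_n ∈ ℤ`,
`6D_n⁵v_n ∈ ℤ`. [cite: Zudilin2003WellPoised, Theorem 1 (6)] -/
theorem theorem1_inclusions_holds : theorem1_inclusions := by
  intro n
  refine ⟨?_, ?_, ?_, ?_⟩
  · have := (u_pos_ratio n).1; exact_mod_cast this
  · intro hn; have := (v_pos_ratio n hn).1; exact_mod_cast this
  · obtain ⟨z, hz⟩ := isInt_lcmUpto_pow_mul_coefU n 2
    refine ⟨z, ?_⟩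
    rw [← hz, coefU_eq n 2 (by norm_num)]
    norm_num
    ring
  · obtain ⟨z, hz⟩ := isInt_lcmUpto_pow_five_mul_coefV n
    refine ⟨z, ?_⟩
    rw [← hz, coefV_eq]
    ring

end Literature.NumberTheory.Irrationality.Zudilin2003.ZetaFour

end
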